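import Summits.HodgeConjecture.HodgeConjecture.Theses.QbarEnvelope
import Summits.HodgeConjecture.HodgeConjecture.Theses.BoundaryReadout
import Summits.HodgeConjecture.HodgeConjecture.Theses.PeriodDeficiency
import Summits.HodgeConjecture.HodgeConjecture.Theses.MotivatedLefschetzSplit
import Summits.HodgeConjecture.HodgeConjecture.Theorems.QbarEnvelopeEnvelopeStubNumberFieldModel
import Summits.HodgeConjecture.HodgeConjecture.Theorems.AnchorTransportAnchorExistenceStubDefinableOfRigid
import Summits.HodgeConjecture.HodgeConjecture.Theorems.PeriodDeficiencyHodgeConjectureQbarStubLefschetzRange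
import Summits.HodgeConjecture.HodgeConjecture.Theorems.PeriodDeficiencyHodgeConjectureQbarStubLefschetzTransfer
import Literature.AlgebraicGeometry.HodgeTheory.AlgebraicCyclesDefinedOverQbarSpread
import Literature.AlgebraicGeometry.HodgeTheory.IsoTransport
import Literature.AlgebraicGeometry.HodgeTheory.HodgeConjectureQbarVoisin
import Literature.AlgebraicGeometry.HodgeTheory.MotivatedClassesProofs
import Literature.AlgebraicGeometry.Motives.CurveNet

/-!
# Line `andre-transfer` for the crux `HCOverNumberFields` (stmt-HodgeConjecture-1070) —
# TRANSFER to the `ℚ̄`-typed sibling `HodgeConjectureQbar` (stmt-11596) and André's motivated cut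

Strategist line (crux-strategist `cstrat-stmt-HodgeConjecture-1070-s1`, 2026-08-17), registered ALONGSIDE
the birth line `Lines/birth.lean` (Deligne's absolute-Hodge funnel), never replacing it.

## The transfer (PROVED here, no `sorry`)

The crux

  `HCOverNumberFields := ∀ n X, IsSmoothProjective n X → (∃ K [NumberField K] (σ : K →+* ℂ) X₀,
     X ≅ X₀ ×_{K,σ} ℂ) → HodgeConjectureFor n X`

(decls `QbarEnvelope.HCOverNumberFields` = `BoundaryReadout.HCOverNumberFields`, one item, `Iff.rfl`)
is EQUIVALENT, by theorems already in the tree, to the `ℚ̄`-typed sibling crux of route `PeriodDeficiency`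

  `HodgeConjectureQbar := ∀ (σ : ℚ̄ →+* ℂ) n X₀, IsSmoothProjective n (X₀ ×_{ℚ̄,σ} ℂ) →
     HodgeConjectureFor n (X₀ ×_{ℚ̄,σ} ℂ)`      (stmt-HodgeConjecture-11596; verbatim the antecedent of
                                                 `PeriodsPolice.QbarDescent`, stmt-1200):

* `ℚ̄ ⇒ number field` (`hcOverNumberFields_of_hodgeConjectureQbar`): an embedding `σ : K →+* ℂ` of a
  number field factors as `τ ∘ i` through `ℚ̄` (`exists_comp_eq_of_numberField`: `K/ℚ` is algebraic,
  Mathlib `IsAlgClosed.lift` twice), base change is transitive (`QbarFibreAnchors.iso_baseChangeHom_comp_of_rigid`,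
  Mathlib `Over.pullbackComp`), smooth projectivity and `HodgeConjectureFor` transport along isomorphisms
  (`IsSmoothProjective.of_iso`; `IsoTransport.nonempty_hodgeModel_iff_of_iso`,
  `forall_hodgeClass_mem_algebraicClasses_iff_of_iso`);
* `number field ⇒ ℚ̄` (`hodgeConjectureQbar_of_hcOverNumberFields`): `X₀ ×_{ℚ̄,τ} ℂ` smooth projective
  ⟹ `X₀` smooth projective over `ℚ̄` (descent, `isSmoothProjective_of_baseChangeHom`) ⟹ `X₀ ≅ X₁ ⊗_{K,ι} ℚ̄`
  for a number field `K` (EGA IV₃ 8.8.2 (ii), the LANDED `Theorems.stub_numberFieldModel`) ⟹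
  `X₀ ×_τ ℂ ≅ X₁ ⊗_{K, τ∘ι} ℂ`.

Consequence for staffing: stmt-1070 and stmt-11596 are ONE open problem; every line registered on either
crux serves both (`hcOverNumberFields_iff_hodgeConjectureQbar`).

## The line: André's cut by codimension range, transferred verbatim

The registered line of stmt-11596 (`Cruxes/HodgeConjectureQbar/Lines/birth.lean`, lead-reshaped) cuts
`HodgeConjectureQbar` along ANDRÉ'S MOTIVATED CLASSES, by codimension range; two of its four stubs are
LANDED theorems (A: the Lefschetz range `p ≤ 1 ∨ n ≤ p + 1` is algebraic, p147191; D: hard-Lefschetz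
transfer of motivated-ness above the middle, p150101) and two are open. THIS line takes exactly the two
open stubs, WITH THE SAME NAMES AND SIGNATURES (one obligation, two cruxes — as `stub_conjugate_exists`
is shared by the birth lines of stmt-1070 and stmt-15913):

* `stub_hodgeClassesMotivatedQbar_deepMiddle` (B, the transcendence half, OPEN): on `X₀ ×_{ℚ̄,σ} ℂ`,
  rational `(p,p)` classes with `2 ≤ p`, `2p ≤ n` are MOTIVATED (`motivatedClasses`, André 1996 §0.4
  expectation restricted to `ℚ̄`-varieties; a THEOREM on abelian varieties, André Thm. 0.6.2);
* `stub_motivatedClassesAlgebraicQbar_middle` (C, the algebraic-cycles half, OPEN): on `X₀ ×_{ℚ̄,σ} ℂ`,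
  `A_motᵖ(X)_ℂ ≤ Nᵖ H²ᵖ` for `2 ≤ p ≤ n − 2` (⟸ Grothendieck's standard conjecture `B`, André §2.1).

and composes them, with the landed A and D, the proved `HodgeModelsExist_holds` and the PROVED transfer,
into the crux BY NAME: `HCOverNumberFields_of : B-sig → C-sig → QbarEnvelope.HCOverNumberFields`
(no `sorry`), `HCOverNumberFields_of_stubs`, and the `BoundaryReadout` spelling.

Why it dodges the stuck goal of `birth`: the birth line's heart `stub_absoluteHodge_algebraic_of_numberField`
("absolute Hodge ⇒ algebraic on arithmetic varieties") has no engine in print beyond abelian fourfolds;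
André's cut moves the transcendence content UP (motivated is stronger than absolute Hodge: André Thm. 0.5,
tree fact `Andre1996_isAbsoluteHodgeClass_of_mem_motivatedClasses`) so that the algebraicity half becomes
standard conjecture `B` — a statement about ONE explicit class (the Lefschetz involution) per variety, with
its own engines (Lieberman for abelian varieties, Charles–Markman for HK of K3^[n] type, arXiv:1009.0413) —
and on the decisive CM-abelian sector B is André's THEOREM (0.6.2), so there the whole crux is stub C.
Hinges (proved): `stub_hodgeClassesMotivatedQbar_deepMiddle_of_item` (B ⟸ crux
`MotivatedLefschetzSplit.HodgeClassesMotivated`, stmt-17488) and `stub_motivatedClassesAlgebraicQbar_middle_of_items`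
(C ⟸ `MotivatedLefschetzSplit.LefschetzStandardB` ∧ `DiagonalPullbackAlgebraic`, stmt-17489/17490).

BC5 special cases (sorry-free): `hcOverNumberFields_lefschetzRange` (the crux's cycle clause in the
Lefschetz range, every arithmetic `X`), `hcOverNumberFields_of_le_three` (THE CRUX FOR `n ≤ 3`, outright).

Disproof used: none on file for stmt-1070 (`ledger crux ls`: only `Lines/birth.*`; no `Disproof.lean`, no
`_false_without_` theorems); `ledger negatives --problem HodgeConjecture` (3 entries: MilnorK symbol lift,
Fermat K3 sextic exhaustion, E-line connectivity) — none concerns arithmetic varieties or motivated classes.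
-/

set_option linter.dupNamespace false

noncomputable section

namespace Summit.HodgeConjecture.HodgeConjecture.Cruxes.HCOverNumberFields.AndreTransfer

open CategoryTheory AlgebraicGeometry
open Literature.AlgebraicGeometry.Motives Literature.AlgebraicGeometry.HodgeTheory
open Summit.HodgeConjecture.HodgeConjecture.Theorems (stub_numberFieldModel
  stub_hodgeClassesAlgebraicQbar_lefschetzRange stub_lefschetzTransferMotivatedQbar)
open Summit.HodgeConjecture.HodgeConjecture.Theorems.QbarFibreAnchors (iso_baseChangeHom_comp_of_rigid)
open Summit.HodgeConjecture.HodgeConjecture.Theses.PeriodDeficiency (HodgeConjectureQbar HodgeModelsExist_holds)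
open Summit.HodgeConjecture.HodgeConjecture.Theses.QbarEnvelope (HCOverNumberFields HodgeModels_holds)

/-! ### 1. The transfer `HCOverNumberFields ↔ HodgeConjectureQbar` (proved) -/

/-- **Every embedding of a number field into `ℂ` factors through `ℚ̄`.** For a number field `K` and
`σ : K →+* ℂ` there are `i : K →+* ℚ̄` and `τ : ℚ̄ →+* ℂ` with `τ ∘ i = σ`: `K/ℚ` is algebraic, so
`i` exists (`IsAlgClosed.lift`); `ℚ̄` is algebraic over `i(K)`, so the `K`-algebra map `τ` into the
algebraically closed `K`-algebra `(ℂ, σ)` exists (`IsAlgClosed.lift` again). [folklore] -/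
theorem exists_comp_eq_of_numberField (K : Type) [Field K] [NumberField K] (σ : K →+* ℂ) :
    ∃ (i : K →+* AlgebraicClosure ℚ) (τ : AlgebraicClosure ℚ →+* ℂ), τ.comp i = σ := by
  classical
  haveI : Algebra.IsAlgebraic ℚ K := Algebra.IsAlgebraic.of_finite ℚ K
  let i : K →ₐ[ℚ] AlgebraicClosure ℚ := IsAlgClosed.lift
  letI : Algebra K (AlgebraicClosure ℚ) := i.toRingHom.toAlgebra
  letI : Algebra K ℂ := σ.toAlgebra
  haveI : IsScalarTower ℚ K (AlgebraicClosure ℚ) :=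
    IsScalarTower.of_algebraMap_eq fun x ↦ by
      show algebraMap ℚ (AlgebraicClosure ℚ) x = i.toRingHom (algebraMap ℚ K x)
      simp
  haveI : Algebra.IsAlgebraic ℚ (AlgebraicClosure ℚ) := AlgebraicClosure.isAlgebraic ℚ
  haveI : Algebra.IsAlgebraic K (AlgebraicClosure ℚ) := Algebra.IsAlgebraic.tower_top (K := ℚ) K
  let τ : AlgebraicClosure ℚ →ₐ[K] ℂ := IsAlgClosed.lift
  exact ⟨i.toRingHom, τ.toRingHom, RingHom.ext fun x ↦ τ.commutes x⟩

/-- **`HodgeConjectureFor` transports along isomorphisms of `ℂ`-schemes** (Hodge models, rational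
`(p,p)` classes and algebraic classes all do: `IsoTransport`). [cite: SerreGAGA1956, §2] -/
theorem hodgeConjectureFor_of_iso {n : ℕ} {X X' : SchemeOver ℂ} (e : X' ≅ X)
    (h : HodgeConjectureFor n X) : HodgeConjectureFor n X' :=
  ⟨(nonempty_hodgeModel_iff_of_iso e).2 h.1,
    fun p ↦ (forall_hodgeClass_mem_algebraicClasses_iff_of_iso (n := n) e p).2 (h.2 p)⟩

/-- **`ℚ̄`-form ⇒ number-field form.** If the Hodge conjecture holds for every smooth projective
`X₀ ×_{ℚ̄,τ} ℂ`, it holds for every smooth projective complex variety definable over a number field: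
`X ≅ X₀ ⊗_{K,σ} ℂ = X₀ ⊗_{K,τ∘i} ℂ ≅ (X₀ ⊗_{K,i} ℚ̄) ⊗_{ℚ̄,τ} ℂ`. [cite: Voisin2007HodgeLoci, Rem. 1.4] -/
theorem hcOverNumberFields_of_hodgeConjectureQbar (h : HodgeConjectureQbar) : HCOverNumberFields := by
  rintro n X hX ⟨K, _, _, σ, X₀, ⟨e⟩⟩
  obtain ⟨i, τ, hτ⟩ := exists_comp_eq_of_numberField K σ
  subst hτ
  obtain ⟨e₂⟩ := iso_baseChangeHom_comp_of_rigid i τ X₀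
  have e' : X ≅ (baseChangeHom τ).obj ((baseChangeHom i).obj X₀) := e ≪≫ e₂.symm
  exact hodgeConjectureFor_of_iso e' (h τ (hX.of_iso e'))

/-- **Number-field form ⇒ `ℚ̄`-form.** If the Hodge conjecture holds for every smooth projective complex
variety definable over a number field, it holds for every smooth projective `X₀ ×_{ℚ̄,τ} ℂ`: `X₀` is
smooth projective over `ℚ̄` (descent, `isSmoothProjective_of_baseChangeHom`), hence `X₀ ≅ X₁ ⊗_{K,ι} ℚ̄`
for a number field `K` (EGA IV₃ 8.8.2 (ii): the landed `Theorems.stub_numberFieldModel`), and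
`X₀ ×_τ ℂ ≅ X₁ ⊗_{K,τ∘ι} ℂ`. [cite: EGAIV3, Thm. 8.8.2 (ii)] [cite: GortzWedhorn2020, Prop. 10.75] -/
theorem hodgeConjectureQbar_of_hcOverNumberFields (h : HCOverNumberFields) : HodgeConjectureQbar := by
  intro τ n X₀ hX
  have hX₀ : IsSmoothProjective n X₀ := isSmoothProjective_of_baseChangeHom τ X₀ hX
  obtain ⟨K, _, _, ι, X₁, ⟨e₁⟩⟩ := stub_numberFieldModel X₀ hX₀
  obtain ⟨e₂⟩ := iso_baseChangeHom_comp_of_rigid ι τ X₁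
  exact h hX ⟨K, inferInstance, inferInstance, τ.comp ι, X₁, ⟨(baseChangeHom τ).mapIso e₁ ≪≫ e₂⟩⟩

/-- **THE TRANSFER: stmt-1070 ⟺ stmt-11596.** `QbarEnvelope.HCOverNumberFields` (= `BoundaryReadout.…`)
is equivalent to `PeriodDeficiency.HodgeConjectureQbar` (= the antecedent of `PeriodsPolice.QbarDescent`).
[cite: Voisin2007HodgeLoci, Rem. 1.4] [cite: EGAIV3, Thm. 8.8.2 (ii)] -/
theorem hcOverNumberFields_iff_hodgeConjectureQbar : HCOverNumberFields ↔ HodgeConjectureQbar :=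
  ⟨hodgeConjectureQbar_of_hcOverNumberFields, hcOverNumberFields_of_hodgeConjectureQbar⟩

/-- The two route spellings of the crux are one statement (`Iff.rfl`). [folklore] -/
theorem boundaryReadout_hcOverNumberFields_iff :
    Summit.HodgeConjecture.HodgeConjecture.Theses.BoundaryReadout.HCOverNumberFields ↔ HCOverNumberFields :=
  Iff.rfl

/-- `PeriodsPolice.QbarDescent`'s antecedent is `HodgeConjectureQbar`, verbatim (`Iff.rfl`). [folklore] -/
theorem hodgeConjectureQbar_iff_forall :
    HodgeConjectureQbar ↔
      ∀ (σ : AlgebraicClosure ℚ →+* ℂ) ⦃n : ℕ⦄ ⦃X₀ : SchemeOver (AlgebraicClosure ℚ)⦄,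
        IsSmoothProjective n ((baseChangeHom σ).obj X₀) → HodgeConjectureFor n ((baseChangeHom σ).obj X₀) :=
  Iff.rfl

/-! ### 2. The two registered stubs (verbatim the open stubs B, C of `Cruxes/HodgeConjectureQbar/Lines/birth.lean`) -/

/-- **STUB B — Hodge classes of the deep middle range on `ℚ̄`-varieties are motivated** (the
transcendence half, OPEN; SAME NAME AND SIGNATURE as stub B of the registered line of stmt-11596 — one
landing closes both): for every `σ : ℚ̄ →+* ℂ`, every smooth projective `X = X₀ ×_{ℚ̄,σ} ℂ` of
dimension `n` and every `p` with `2 ≤ p`, `2p ≤ n`, every rational class of Hodge type `(p,p)` in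
`H²ᵖ(X(ℂ); ℂ)` lies in André's `A_motᵖ(X)_ℂ = motivatedClasses n X p`. Why plausibly true: André 1996
§0.4 (expected for all `X`; it follows from HC since algebraic classes are motivated); a THEOREM on
abelian varieties (André Thm. 0.6.2, tree fact `Andre1996_hodgeClasses_abelianVariety_motivated`) and the
`ℚ̄`-restriction exposes André's motivated Galois group / period torsor (route `PeriodsPolice`,
`CompactCommutantTrivial`, stmt-14651, concludes exactly this inclusion in Weil-cohomology typing). Why it
might fail / why hard: off the abelian-motive sector no engine produces motivated classes; a rational
`(p,p)` class on a `ℚ̄`-variety that is not motivated is not absolute Hodge-by-André and would refute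
HC. Verbatim the `ℚ̄`-restriction of crux `MotivatedLefschetzSplit.HodgeClassesMotivated` (stmt-17488).
[cite: Andre1996Motifs, §0.4, Thm. 0.4, Thm. 0.6.2] [cite: Deligne1982HodgeCycles, Thm. 2.11] -/
theorem stub_hodgeClassesMotivatedQbar_deepMiddle :
    ∀ (σ : AlgebraicClosure ℚ →+* ℂ) ⦃n : ℕ⦄ ⦃X₀ : SchemeOver (AlgebraicClosure ℚ)⦄,
      IsSmoothProjective n ((baseChangeHom σ).obj X₀) →
        ∀ (p : ℕ), 2 ≤ p → 2 * p ≤ n →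
          ∀ (c : complexBetti ((baseChangeHom σ).obj X₀) (2 * p)),
            IsRationalClass c → IsOfHodgeType n ((baseChangeHom σ).obj X₀) (2 * p) p p c →
              c ∈ motivatedClasses n ((baseChangeHom σ).obj X₀) p := by
  sorry

/-- **STUB C — motivated classes of the middle range on `ℚ̄`-varieties are algebraic** (the
algebraic-cycles half, OPEN; SAME NAME AND SIGNATURE as stub C of the registered line of stmt-11596):
for every `σ : ℚ̄ →+* ℂ`, every smooth projective `X = X₀ ×_{ℚ̄,σ} ℂ` of dimension `n` and every `p`
with `2 ≤ p ≤ n − 2`, `A_motᵖ(X)_ℂ ≤ Nᵖ H²ᵖ(X(ℂ); ℂ) = algebraicClasses X p`. Why plausibly true: it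
follows from Grothendieck's standard conjecture of Lefschetz type `B` for the auxiliary varieties
(André 1996 §2.1, remark after Déf. 1; tree: `Andre1996_motivatedClasses_le_algebraicClasses_of_standardConjectureB`,
and the PROVED reduction `motivatedClasses_le_algebraicClasses_of_standardConjectureB_of_map_diagonal`);
`B` is known for curves, surfaces, abelian varieties (Lieberman 1968), complete intersections, flag
varieties, HK of K3^[n] type (Charles–Markman, arXiv:1009.0413). Why it might fail / why hard: in the
middle range it IS Grothendieck's `B` in André's reading (`A_mot = A` on a product-closed family ⟺ `B`
there, André Prop. 2.2), open since 1968. Same statement as the `ℚ̄`-restriction of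
`PeriodsPolice.LefschetzB` (stmt-10505) in real-carrier typing.
[cite: Andre1996Motifs, §2.1 and Prop. 2.2] [cite: Kleiman1968, Prop. 2.3] [cite: Lieberman1968] -/
theorem stub_motivatedClassesAlgebraicQbar_middle :
    ∀ (σ : AlgebraicClosure ℚ →+* ℂ) ⦃n : ℕ⦄ ⦃X₀ : SchemeOver (AlgebraicClosure ℚ)⦄,
      IsSmoothProjective n ((baseChangeHom σ).obj X₀) →
        ∀ p : ℕ, 2 ≤ p → p + 2 ≤ n →
          motivatedClasses n ((baseChangeHom σ).obj X₀) p ≤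
            algebraicClasses ((baseChangeHom σ).obj X₀) p := by
  sorry

/-! ### 3. The composition: B → C → the crux, by name (no `sorry`) -/

/-- **Glue on `ℚ̄`-models** (kernel-checked, no `sorry`): stubs B and C, the LANDED stub A
(`Theorems.stub_hodgeClassesAlgebraicQbar_lefschetzRange`, Lefschetz `(1,1)` + hard Lefschetz) and the
LANDED stub D (`Theorems.stub_lefschetzTransferMotivatedQbar`, hard-Lefschetz transfer of motivated-ness to
`n < 2p ≤ 2n − 4`) give "rational `(p,p)` ⇒ algebraic" on every smooth projective `X₀ ×_{ℚ̄,σ} ℂ` in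
EVERY codimension (case split `p ≤ 1 ∨ n ≤ p + 1` / `2 ≤ p ≤ n − 2`, the latter `2p ≤ n` / `n < 2p`).
[cite: Andre1996Motifs, §2.1] [cite: VoisinHodgeI2002, Thm. 6.25 and Thm. 11.30] -/
theorem hodgeClassesAlgebraicQbar_of_stubs
    (hB : ∀ (σ : AlgebraicClosure ℚ →+* ℂ) ⦃n : ℕ⦄ ⦃X₀ : SchemeOver (AlgebraicClosure ℚ)⦄,
      IsSmoothProjective n ((baseChangeHom σ).obj X₀) →
        ∀ (p : ℕ), 2 ≤ p → 2 * p ≤ n →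
          ∀ (c : complexBetti ((baseChangeHom σ).obj X₀) (2 * p)),
            IsRationalClass c → IsOfHodgeType n ((baseChangeHom σ).obj X₀) (2 * p) p p c →
              c ∈ motivatedClasses n ((baseChangeHom σ).obj X₀) p)
    (hC : ∀ (σ : AlgebraicClosure ℚ →+* ℂ) ⦃n : ℕ⦄ ⦃X₀ : SchemeOver (AlgebraicClosure ℚ)⦄,
      IsSmoothProjective n ((baseChangeHom σ).obj X₀) →
        ∀ p : ℕ, 2 ≤ p → p + 2 ≤ n →
          motivatedClasses n ((baseChangeHom σ).obj X₀) p ≤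
            algebraicClasses ((baseChangeHom σ).obj X₀) p) :
    ∀ (σ : AlgebraicClosure ℚ →+* ℂ) ⦃n : ℕ⦄ ⦃X₀ : SchemeOver (AlgebraicClosure ℚ)⦄,
      IsSmoothProjective n ((baseChangeHom σ).obj X₀) →
        ∀ (p : ℕ) (c : complexBetti ((baseChangeHom σ).obj X₀) (2 * p)),
          IsRationalClass c → IsOfHodgeType n ((baseChangeHom σ).obj X₀) (2 * p) p p c →
            c ∈ algebraicClasses ((baseChangeHom σ).obj X₀) p := by
  intro σ n X₀ hX p c hc hpp
  by_cases hp : p ≤ 1 ∨ n ≤ p + 1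
  · exact stub_hodgeClassesAlgebraicQbar_lefschetzRange σ hX p hp c hc hpp
  · refine hC σ hX p (by omega) (by omega) ?_
    by_cases h2 : 2 * p ≤ n
    · exact hB σ hX p (by omega) h2 c hc hpp
    · exact stub_lefschetzTransferMotivatedQbar σ hX
        (fun q hq2 hqn c' hc' hqq ↦ hB σ hX q hq2 hqn c' hc' hqq) p (by omega) (by omega) c hc hpp

/-- **THE LINE'S COMPOSITION** (kernel-checked, no `sorry`): if Hodge classes of the deep middle range on
smooth projective `ℚ̄`-varieties are motivated (STUB B) and motivated classes of the middle range on them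
are algebraic (STUB C), then `HCOverNumberFields`: on `ℚ̄`-models the anti-vacuity conjunct is the proved
route item `PeriodDeficiency.HodgeModelsExist_holds` and the cycle clause is
`hodgeClassesAlgebraicQbar_of_stubs`; the number-field form follows by the PROVED transfer
`hcOverNumberFields_of_hodgeConjectureQbar`. Concludes the crux BY NAME
(`Summit.HodgeConjecture.HodgeConjecture.Theses.QbarEnvelope.HCOverNumberFields`).
[cite: Andre1996Motifs, §0.4 and §2.1] [cite: Voisin2007HodgeLoci, Rem. 1.4] -/
theorem HCOverNumberFields_of
    (hB : ∀ (σ : AlgebraicClosure ℚ →+* ℂ) ⦃n : ℕ⦄ ⦃X₀ : SchemeOver (AlgebraicClosure ℚ)⦄,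
      IsSmoothProjective n ((baseChangeHom σ).obj X₀) →
        ∀ (p : ℕ), 2 ≤ p → 2 * p ≤ n →
          ∀ (c : complexBetti ((baseChangeHom σ).obj X₀) (2 * p)),
            IsRationalClass c → IsOfHodgeType n ((baseChangeHom σ).obj X₀) (2 * p) p p c →
              c ∈ motivatedClasses n ((baseChangeHom σ).obj X₀) p)
    (hC : ∀ (σ : AlgebraicClosure ℚ →+* ℂ) ⦃n : ℕ⦄ ⦃X₀ : SchemeOver (AlgebraicClosure ℚ)⦄,
      IsSmoothProjective n ((baseChangeHom σ).obj X₀) →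
        ∀ p : ℕ, 2 ≤ p → p + 2 ≤ n →
          motivatedClasses n ((baseChangeHom σ).obj X₀) p ≤
            algebraicClasses ((baseChangeHom σ).obj X₀) p) :
    Summit.HodgeConjecture.HodgeConjecture.Theses.QbarEnvelope.HCOverNumberFields :=
  hcOverNumberFields_of_hodgeConjectureQbar fun σ n X₀ hX ↦
    ⟨HodgeModelsExist_holds n _ hX, fun p c hc hpp ↦ hodgeClassesAlgebraicQbar_of_stubs hB hC σ hX p c hc hpp⟩

/-- **The crux, closed modulo exactly the two registered stubs.** -/
theorem HCOverNumberFields_of_stubs :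
    Summit.HodgeConjecture.HodgeConjecture.Theses.QbarEnvelope.HCOverNumberFields :=
  HCOverNumberFields_of stub_hodgeClassesMotivatedQbar_deepMiddle stub_motivatedClassesAlgebraicQbar_middle

/-- The same, in the `BoundaryReadout` spelling of the shared item (definitionally the same statement). -/
theorem boundaryReadout_HCOverNumberFields_of_stubs :
    Summit.HodgeConjecture.HodgeConjecture.Theses.BoundaryReadout.HCOverNumberFields :=
  HCOverNumberFields_of_stubs

/-! ### 4. Hinges: where the two open stubs sit in the hub (no `sorry`) -/

/-- **STUB B is the `ℚ̄`-specialisation of crux `MotivatedLefschetzSplit.HodgeClassesMotivated`**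
(stmt-HodgeConjecture-17488: on EVERY smooth projective complex `X`, rational `(p,p)` classes with
`2 ≤ p`, `2p ≤ n` are motivated). [cite: Andre1996Motifs, §0.4] -/
theorem stub_hodgeClassesMotivatedQbar_deepMiddle_of_item
    (hHM : Summit.HodgeConjecture.HodgeConjecture.Theses.MotivatedLefschetzSplit.HodgeClassesMotivated) :
    ∀ (σ : AlgebraicClosure ℚ →+* ℂ) ⦃n : ℕ⦄ ⦃X₀ : SchemeOver (AlgebraicClosure ℚ)⦄,
      IsSmoothProjective n ((baseChangeHom σ).obj X₀) →
        ∀ (p : ℕ), 2 ≤ p → 2 * p ≤ n →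
          ∀ (c : complexBetti ((baseChangeHom σ).obj X₀) (2 * p)),
            IsRationalClass c → IsOfHodgeType n ((baseChangeHom σ).obj X₀) (2 * p) p p c →
              c ∈ motivatedClasses n ((baseChangeHom σ).obj X₀) p :=
  fun _ _ _ hX p hp2 hpn c hc hpp ↦ hHM hX p hp2 hpn c hc hpp

/-- **STUB C follows from cruxes `MotivatedLefschetzSplit.LefschetzStandardB` and
`MotivatedLefschetzSplit.DiagonalPullbackAlgebraic`** (stmt-17489 = Grothendieck's `B` in André's
`*_L`-form for every smooth projective complex `Z`; stmt-17490 = Voisin II Prop. 9.21 (i)), by the tree's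
PROVED reduction `motivatedClasses_le_algebraicClasses_of_standardConjectureB_of_map_diagonal` — in every
codimension, in particular in the middle range. [cite: Andre1996Motifs, §2.1] [cite: VoisinHodgeII2003, Prop. 9.21] -/
theorem stub_motivatedClassesAlgebraicQbar_middle_of_items
    (hB : Summit.HodgeConjecture.HodgeConjecture.Theses.MotivatedLefschetzSplit.LefschetzStandardB)
    (hΔ : Summit.HodgeConjecture.HodgeConjecture.Theses.MotivatedLefschetzSplit.DiagonalPullbackAlgebraic) :
    ∀ (σ : AlgebraicClosure ℚ →+* ℂ) ⦃n : ℕ⦄ ⦃X₀ : SchemeOver (AlgebraicClosure ℚ)⦄,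
      IsSmoothProjective n ((baseChangeHom σ).obj X₀) →
        ∀ p : ℕ, 2 ≤ p → p + 2 ≤ n →
          motivatedClasses n ((baseChangeHom σ).obj X₀) p ≤
            algebraicClasses ((baseChangeHom σ).obj X₀) p :=
  fun _ _ _ hX p _ _ ↦ motivatedClasses_le_algebraicClasses_of_standardConjectureB_of_map_diagonal hΔ hB hX p

/-! ### 5. Sanity: special cases of the crux, proved outright (BC5), and the HC-safety of the stubs -/

/-- **BC5 (a): the crux's cycle clause holds in the Lefschetz range on every arithmetic variety**
(`p ≤ 1 ∨ n ≤ p + 1`: `p = 0`, Lefschetz `(1,1)`, hard Lefschetz for `n − p ≤ 1`, `p > n`), by the tree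
theorem `mem_algebraicClasses_of_lefschetzRange` (valid for every smooth projective complex `X`).
[cite: VoisinHodgeI2002, Thm. 6.25 and Thm. 11.30] -/
theorem hcOverNumberFields_lefschetzRange :
    ∀ ⦃n : ℕ⦄ ⦃X : SchemeOver ℂ⦄, IsSmoothProjective n X →
      ∀ (p : ℕ), (p ≤ 1 ∨ n ≤ p + 1) →
        ∀ (c : complexBetti X (2 * p)), IsRationalClass c → IsOfHodgeType n X (2 * p) p p c →
          c ∈ algebraicClasses X p :=
  fun n X hX _ hp c hc hpp ↦
    mem_algebraicClasses_of_lefschetzRange lefschetzOneOne_rational_holds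
      (nonempty_hardLefschetzNFold_holds n X) hX hp c hc hpp

/-- **BC5 (b): THE CRUX FOR `n ≤ 3`, unconditionally** — every codimension is in the Lefschetz range,
and Hodge models exist (`QbarEnvelope.HodgeModels_holds`). In particular `HCOverNumberFields` is
inhabited-in-kind: its open content starts at arithmetic FOURFOLDS, `p = 2`.
[cite: VoisinHodgeI2002, Thm. 11.30] [cite: Murre1977, Rem. 1] -/
theorem hcOverNumberFields_of_le_three :
    ∀ ⦃n : ℕ⦄ ⦃X : SchemeOver ℂ⦄, n ≤ 3 → IsSmoothProjective n X →
      (∃ (K : Type) (_ : Field K) (_ : NumberField K) (σ : K →+* ℂ) (X₀ : SchemeOver K),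
        Nonempty (X ≅ (baseChangeHom σ).obj X₀)) →
      HodgeConjectureFor n X :=
  fun n X hn hX _ ↦
    ⟨(HodgeModels_holds n X).nonempty hX,
      fun p c hc hpp ↦ hcOverNumberFields_lefschetzRange hX p (by omega) c hc hpp⟩

/-- **No costume: the crux implies STUB C's conclusion on Hodge classes only through STUB B's
vocabulary** — what the crux gives directly is "rational `(p,p)` ⇒ algebraic" on `ℚ̄`-models
(`hodgeConjectureQbar_of_hcOverNumberFields`), i.e. neither stub is the crux reworded: B concludes
MOTIVATED (not algebraic), C assumes MOTIVATED (not Hodge). Recorded as the unfolding of the transfer. -/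
theorem hodgeClassesAlgebraicQbar_of_crux (h : HCOverNumberFields) :
    ∀ (σ : AlgebraicClosure ℚ →+* ℂ) ⦃n : ℕ⦄ ⦃X₀ : SchemeOver (AlgebraicClosure ℚ)⦄,
      IsSmoothProjective n ((baseChangeHom σ).obj X₀) →
        ∀ (p : ℕ) (c : complexBetti ((baseChangeHom σ).obj X₀) (2 * p)),
          IsRationalClass c → IsOfHodgeType n ((baseChangeHom σ).obj X₀) (2 * p) p p c →
            c ∈ algebraicClasses ((baseChangeHom σ).obj X₀) p :=
  fun σ _ _ hX p c hc hpp ↦ ((hodgeConjectureQbar_of_hcOverNumberFields h) σ hX).2 p c hc hpp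

end Summit.HodgeConjecture.HodgeConjecture.Cruxes.HCOverNumberFields.AndreTransfer

end
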